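import Summits.BirchSwinnertonDyer.BirchSwinnertonDyer.Theorems.ClassRecordThreeEulerHalvesAtThreeHybrid
import Summits.BirchSwinnertonDyer.BirchSwinnertonDyer.Theorems.ClassRecordThreeEulerHalvesAtThreePoitouTateOfCanonical
import Summits.BirchSwinnertonDyer.BirchSwinnertonDyer.Theorems.ClassRecordThreeEulerHalvesAtThreeTwistLowerOfX11a
import Summits.BirchSwinnertonDyer.BirchSwinnertonDyer.Theorems.SchneiderFreeAdditiveX3PoitouTateReciprocitySumHolds
import Summits.BirchSwinnertonDyer.BirchSwinnertonDyer.Theorems.ClassRecordThreeEulerHalvesAtThreeCoStepLDefs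
import Summits.BirchSwinnertonDyer.BirchSwinnertonDyer.Theorems.ClassRecordThreeEulerHalvesAtThreeCartanKernelOfInputs
import Summits.BirchSwinnertonDyer.BirchSwinnertonDyer.Theorems.ClassRecordThreeEulerHalvesAtThreeOfItemsR21
import HarnessLib

/-!
# Crux `EulerHalvesAtThreeResidualUpperBound` (OUTPUT-form residue of 19109; RULING 78: placement (α) UPHELD, crux filed on CR3 + KR3 `:= Theorems.EulerHalvesAtThreeResidualUpperBound` BY NAME) —
# line `costepl`, skeleton v2 (tam3-p1 g19, 2026-08-28, RULING 78): the IMC-form item 23334 through the co-chain conversions — ZERO stubs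

`EulerHalvesAtThreeResidualUpperBound_of` binds EXACTLY the route items 19112 `PublishedInputsThree`, 23176
`PoitouTateShaTateDualFact`, 23178 `X11aLowerHalfAtThree`, 23334 `EulerHalvesAtThreeCoStepLResidual` BY NAME and concludes
    (Z)  ∀ W, ClassX11b W 3 → Surj W 3 → MultiCarrierAt W → ResidualNormalFormAt W → Typed.MissingUpperBoundAt W 3
BY NAME (`Theses.ClassRecordThree.EulerHalvesAtThreeResidualUpperBound := Theorems.EulerHalvesAtThreeResidualUpperBound`, Defs p665127; `_of'` the KR3 twin). Proof = closers p665485 §2 (inlined): item 23334 gives `CoStepLAt W` on the residual class, and corner3 g0's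
one-curve co-chain theorems (`Koly.missingUpperBoundAt_three_of_classX11b_of_ram_of_coStepLAt` if (ram), `…_of_surj_of_coStepLAt_of_twistLower` with
TL₃ from 23178 otherwise) turn it into the bound. 0 `sorry`. What is OPEN is item 23334 (BEYOND PRINT). Nothing is asserted about any curve (T7).
-/

set_option linter.dupNamespace false
set_option autoImplicit false

noncomputable section

open scoped Classical NumberField Pointwise

namespace Summit.BirchSwinnertonDyer.BirchSwinnertonDyer.Cruxes.EulerHalvesAtThreeResidualUpperBound.CoStepL

open WeierstrassCurve IsDedekindDomain NumberField Field Literature.NumberTheory.EllipticCurves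
  Literature.NumberTheory.EllipticCurves.ModularForms Literature.NumberTheory.EllipticCurves.Jetchev2008
  Literature.NumberTheory.EllipticCurves.KolyvaginCocycle
  Literature.NumberTheory.EllipticCurves.Rank1Residual Literature.NumberTheory.GaloisRepresentations
  Literature.NumberTheory.GaloisCohomology Literature.NumberTheory.Automorphic CongruenceSubgroup
  Summit.BirchSwinnertonDyer.Rank1Residual Summit.BirchSwinnertonDyer.Rank1Residual.X11b
  Summit.BirchSwinnertonDyer.Rank1Residual.X11b.Three Summit.BirchSwinnertonDyer.Rank1Residual.X11b.Three.Koly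
  Summit.BirchSwinnertonDyer.Rank1Residual.X11b.AcSelmer
  Summit.BirchSwinnertonDyer.BirchSwinnertonDyer.Theorems

/-- The Selmer-structure Poitou–Tate duality — a KERNEL THEOREM (bsd-schneider's `selmerComplement_canonical_holds`). [cite: MilneADT2006, I Thm. 4.10] -/
theorem hPT_holds : ∀ (K : Type) [Field K] [NumberField K], poitouTate_selmerStructure_duality K := fun K _ _ ↦
  poitouTate_selmerStructure_duality_of_conj
    (poitouTate_conj_forall_of_selmerComplement_canonical (fun K _ _ n _ ↦
      Summit.BirchSwinnertonDyer.BirchSwinnertonDyer.Theorems.SchneiderFreeAdditiveX3.PoitouTateReduction.selmerComplement_canonical_holds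
        K n) K)

/-- TL₃ — DERIVED from item 23178 `X11aLowerHalfAtThree` and three conjuncts of `PublishedInputsThree` (mult-p3 g0's
`Koly.twistLowerAtThree_of_thmC_of_x11aLowerHalfAtThree`). [cite: Skinner2016PacificMC, Thm. C (§1)] -/
theorem twistLowerAtThree_of_items
    (h : Summit.BirchSwinnertonDyer.BirchSwinnertonDyer.Theses.ClassRecordThree.PublishedInputsThree)
    (hX : Summit.BirchSwinnertonDyer.BirchSwinnertonDyer.Theses.ClassRecordThree.X11aLowerHalfAtThree) :
    ∀ (V : WeierstrassCurve ℚ) [V.IsElliptic] [V.IsGloballyMinimal],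
      V.HasMultiplicativeReductionAtPrime 3 → V.HasIrreducibleModPGaloisRep 3 →
      V.entireLFunction 1 ≠ 0 → Finite V.sha →
      ∃ q : ℚ, V.entireLFunction 1 / (V.realPeriodRat : ℂ) = (q : ℂ) ∧
        padicValRat 3 q ≤ (padicValNat 3 V.shaOrder : ℤ) + padicValNat 3 V.tamagawaProduct -
          2 * padicValNat 3 V.torsionOrder := by
  obtain ⟨-, -, -, hSk, -, hGZK, hmod, -, -, -, -, -, -, -, -, -, -, -, -, -⟩ := h
  exact Koly.twistLowerAtThree_of_thmC_of_x11aLowerHalfAtThree hmod hGZK hSk hX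

/-- **The co-chain conversion at ONE curve, (ram) or not**: `CoStepLAt W` ∧ X11b ∧ surj ⟹ `Typed.MissingUpperBoundAt W 3` from the items
19112 ∕ 23176 ∕ 23178 (corner3 g0's two one-curve theorems; = `EulerHalvesResidualUB.missingUpperBoundAt_three_of_classX11b_of_surj_of_coStepLAt`
of the closers file p665485, inlined). [cite: JetchevSkinnerWan2017, §7.4.2 (arXiv:1512.06894 p. 31)] [cite: Castella2018, Thm. 3.2 (shape)] -/
theorem missingUpperBoundAt_of_coStepLAt_of_items
    (h : Summit.BirchSwinnertonDyer.BirchSwinnertonDyer.Theses.ClassRecordThree.PublishedInputsThree)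
    (hPT2 : Summit.BirchSwinnertonDyer.BirchSwinnertonDyer.Theses.ClassRecordThree.PoitouTateShaTateDualFact)
    (hX : Summit.BirchSwinnertonDyer.BirchSwinnertonDyer.Theses.ClassRecordThree.X11aLowerHalfAtThree)
    (W : WeierstrassCurve ℚ) [W.IsElliptic] [W.IsGloballyMinimal]
    (hco : CoStepLAt W) (hXW : ClassX11b W 3) (hρ : Surj W 3) : Typed.MissingUpperBoundAt W 3 := by
  have hTL := twistLowerAtThree_of_items h hX
  obtain ⟨hGZ, hKo, -, hSk, -, hGZK, hmod, hnf, hHL, hMaz, -, -, -, -, -, -, -, -, -, -⟩ := h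
  by_cases hram : Ram W 3
  · exact Koly.missingUpperBoundAt_three_of_classX11b_of_ram_of_coStepLAt hGZ hKo hSk hGZK hmod hnf hHL hMaz hPT_holds hPT2
      W hco hXW hram
  · exact Koly.missingUpperBoundAt_three_of_classX11b_of_surj_of_coStepLAt_of_twistLower hGZ hKo hGZK hmod hnf hHL hMaz
      hPT_holds hPT2 hTL W hco hXW hρ

/-- **COMPOSITION — (Z) from the four items BY NAME, zero stubs.** [cite: JetchevSkinnerWan2017, §7.4.2 (p. 31)] [cite: Castella2018, Thm. 3.2 (shape)] -/
theorem EulerHalvesAtThreeResidualUpperBound_of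
    (h : Summit.BirchSwinnertonDyer.BirchSwinnertonDyer.Theses.ClassRecordThree.PublishedInputsThree)
    (hPT2 : Summit.BirchSwinnertonDyer.BirchSwinnertonDyer.Theses.ClassRecordThree.PoitouTateShaTateDualFact)
    (hX : Summit.BirchSwinnertonDyer.BirchSwinnertonDyer.Theses.ClassRecordThree.X11aLowerHalfAtThree)
    (hRes : Summit.BirchSwinnertonDyer.BirchSwinnertonDyer.Theses.ClassRecordThree.EulerHalvesAtThreeCoStepLResidual) :
    Summit.BirchSwinnertonDyer.BirchSwinnertonDyer.Theses.ClassRecordThree.EulerHalvesAtThreeResidualUpperBound := by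
  intro W _ _ hXW hρ hm hr
  exact missingUpperBoundAt_of_coStepLAt_of_items h hPT2 hX W (hRes W hm hr) hXW hρ

/-- **The `KolyvaginRoadThree` twin** (KR3's copies of 23176 ∕ 23178 ∕ 23334; 19112 is CR3's, shared by id). -/
theorem EulerHalvesAtThreeResidualUpperBound_of'
    (h : Summit.BirchSwinnertonDyer.BirchSwinnertonDyer.Theses.ClassRecordThree.PublishedInputsThree)
    (hPT2 : Summit.BirchSwinnertonDyer.BirchSwinnertonDyer.Theses.KolyvaginRoadThree.PoitouTateShaTateDualFact)
    (hX : Summit.BirchSwinnertonDyer.BirchSwinnertonDyer.Theses.KolyvaginRoadThree.X11aLowerHalfAtThree)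
    (hRes : Summit.BirchSwinnertonDyer.BirchSwinnertonDyer.Theses.KolyvaginRoadThree.EulerHalvesAtThreeCoStepLResidual) :
    Summit.BirchSwinnertonDyer.BirchSwinnertonDyer.Theses.KolyvaginRoadThree.EulerHalvesAtThreeResidualUpperBound :=
  EulerHalvesAtThreeResidualUpperBound_of h hPT2 hX hRes

end Summit.BirchSwinnertonDyer.BirchSwinnertonDyer.Cruxes.EulerHalvesAtThreeResidualUpperBound.CoStepL

end
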